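import Summits.ABC.IUTFork.Repair.RHAxisCK1Requirements
import Summits.ABC.IUTFork.Repair.RHReqsideShellProfile
import Summits.ABC.IUTFork.Repair.RHReqsidePairPK3CM2764
import Literature.IUT.LogVolume.TensorPacketRing
import HarnessLib

/-!
# R-H ROUND-3 AXIS C, item (b) TYPING LANE (ruling R79, KEY «C-TYPE-K1» item (3)): knob family k3 (radius multiplier `c` on `(R_in, R_out)`) —
# the NEW-THEORY REQUIREMENTS of the k3 sheets CFG-13/14/15 (family K3-CHALF, `c = ½`) as claim-tagged `Prop`s over the landed currency

abc-iut cell, rung LADDER-ABC:A2.RESCUE.H. Target path `Summits/ABC/IUTFork/Repair/RHAxisCK3Requirements.lean` (KEY `wake/KEY-abc-iut-reqb-typ-1-C-TYPE-K1.md` item (3):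
«k3 (CFG-13–15, rh3-gen-5: `RHAxisCK3Requirements.lean`) … one file per family, same rules»; filer = the R79 lane abc-iut-reqb-typ-1; desk abc-iut-rh-lead g5, desk file
`plan/rescue/R-H/ROUND3/AXIS-CD-DESK.md` 0c01fcd4427e30c7 §AXIS C; machine list `AXIS-C/AXIS-C-CONFIGS.tsv` 80c35a38b88f1870; referees abc-iut-rh-ref-1 / rh-ref-2).
DRAFTED by the k3 sheet seat abc-iut-rh3-gen-5 (GEN 6) from its private elaboration check `HOME/abc-iut-rh3-gen-5/g5/AxisC_K3CHalf_Reqs.lean` 0ae1bf1fe4c5ddb4 (g5; farm rc 0,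
0 sorries), RE-CUT into the schema of the k1 family file `RHAxisCK1Requirements.lean` (abc-iut-reqb-typ-1 g8/g9; ns `…RH.AxisCK1Requirements`: parametric `R1_licenceLaw a` /
`R1_meets a μ₀`, `CFG15_k1block`; LANDED p534392, tree sha16 d3369b3863c05d3b), which this file IMPORTS and cites BY NAME (nothing re-declared). FILED by the R79 lane
abc-iut-reqb-typ-1 (GEN 9): the sheet seat's draft `HOME/abc-iut-rh3-gen-5/g6/RHAxisCK3Requirements-draft-g6.lean` 8f400617905bff19 (263 l; offer 13:27:01Z, B605) ADOPTED
VERBATIM (this provenance sentence is the only edit), CREDITED to abc-iut-rh3-gen-5 g5/g6; it supersedes the lane's own shorter k3 draft of 13:28Z (same decl schema).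

WHAT THIS FILE IS. D-0127 item (b): «what a theory with this knob value must SUPPLY in place of the printed constructions — the modified objects as claim-tagged Lean
Props `def … : Prop` under Summits/ABC/IUTFork/Repair/, NEVER Literature facts». The k3 knob `c` scales the radii `(R_in, R_out)` of the unit container of [IUTchIV]
Prop 1.2 / Thm 1.10 Step (v)–(vi). The three PRINT objects being replaced are typed in `Literature/IUT/LogVolume/TensorPacketRing.lean` (ns `Literature.IUT.LogVolume`):
the unit container `logPacket p k` (= `⊗ log_p(R_i^×)`), the indeterminacy predicate `IsLogPacketAut p k φ` ((Ind1),(Ind2): `φ '' logPacket = logPacket`) and the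
multiradial display `Prop12ii p k` (exponents `aSum`, `bSum`, `dSum`; realisation `RealizesNegB`). §1 types their replacements PARAMETRICALLY in the multiplier `c : ℝ`
(R-K3C-1 display with inner sacrifice `c·a_I` and reach `c·b_I`; R-K3C-2 Kummer-compatible unit map; assembled `ShellTheory p k c`) with the CALIBRATION
`shellDisplay_one_logPacket_iff`: at `c = 1`, container `log_p(R_I^×)` and group = all lattice automorphisms, the display IS `Prop12ii` as typed. §2 is the CELL side in
the reqside currency BY NAME: R-K3C-3 (translation covariance `hullCellδ_translate` — the invariant content of `c` is the WIDTH) and R-K3C-4 (licence law + MEETS word =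
`AxisCK1Requirements.R1_licenceLaw 4` / `R1_meets 4 μ₀` at the DOUBLED place `(2e, 2m, 2δ; r_in, r_out)`, i.e. `c = ½` in «floor AFTER multiplication» form — label by
label the cell `HullCellδ (2e_w) (2m_w) j (2δ_w) r_in r_out` of `ReqsideWorkedPlace.cHalf_boundary` (p509351) / `ReqsidePairPK3CM2764.twiceMargin_nonneg_iff` (p516979) /
`ReqsideShellProfile.radiusMultiplierCell_print_iff` (p507493)). §3 packages CFG-13 (`μ₀ = 27/64`) and CFG-14 (`μ₀ = ½`); §4 assembles CFG-15 =
`AxisCK1Requirements.CFG15_k1block ∧ ShellTheory p k (1/2)` exactly as announced in that decl's docstring.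

SHEETS TYPED HERE (files of record under `plan/rescue/R-H/ROUND3/AXIS-C/`, sha16 re-hashed first-hand 13:17Z; v3 = names-only errata fold of v2, numbers unchanged):
CFG-13 `CFG-13-P-k3c1_2-k5mu27_64.md` v3 d0138c547453c812 (v1 ff295b78516a9983, v2 fda52d2f3e9e35a8; rh-ref-1 PASS 12:46:45Z) · CFG-14 `CFG-14-P-k3c1_2-k5mu1_2.md` v3
cce89367b8151f51 (v1 ece613b7b944d378, v2 818e1ea223e98016; rh-ref-2 PASS 12:52:10Z, rh-ref-1 PASS 13:10:19Z) · CFG-15 `CFG-15-T-k1kappa3_2-k3c1_2-k5mu1_2.md` v3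
b45c88f34256b594 (v1 66ba623d08ccede3, v2 24ac4adf8a58eac9; rh-ref-1 PASS 12:57:26Z). Items (b) R-K3C-1…4 are byte-identical across the three sheets; R-K5-1 differs only in
`μ₀`; CFG-15 adds R-K1 (= CFG-05 §K32-CORE R1–R6, typed in `RHAxisCK1Requirements.lean`) and R-T (the conjunction at the doubled cell).

HONEST FRAMING / GUARDS: every `def … : Prop` here is a HYPOTHESIS in OUR typed cell currency — a requirement a hypothetical «c = ½ log-shell» theory would have to
meet — not a reading of [IUTchI–IV], not a claim that such objects exist, NEVER a Literature fact (no new `Prop` fact; inputs ⊆ the frozen FACT-LIST f75a60bac22efdb6 +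
the landed interfaces imported above); the `_iff` / `_of_` lemmas are bookkeeping or print-shape calibrations, not evidence for any configuration. The sheets' label
INCONSISTENT (rf-2 k3.c=½: [IUTchIV] Prop 1.2 (i) p.10 + proof p.11, «the radii are equalities of ℤ_p-modules»; kernel face on the CLASSICAL side of the tree:
`Literature.IUT.LogVolume.LogEnvelope.innerRadius_closedForm` / `not_closedBall_div_subset_logUnits` (UnitLogValuationSpectrum.lean) and
`LogEnvelope.isGreatest_norm_logUnits` / `exists_mem_logUnits_norm_eq_envelope` (UnitLogMaxNorm.lean)) is LOCATED, not adjudicated here; typed ≠ proved; computed ≠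
proved; nothing here asserts that abc is proved or refuted, or takes a side on [IUTchIII] Cor. 3.12 / [IUTchIV] Thm. 1.10 or on any author (D-0045).
[claim: Mochizuki2012, status: disputed] [cite: Mochizuki2012, IUTchIV Prop. 1.2 p. 10–11; Thm. 1.10 Step (v)–(vi) p. 27–29; IUTchIII Thm. 3.11 (i)–(ii) p. 154–156,
Prop. 3.5 (ii)(a) p. 104, Rmk. 3.12.1 (ii) p. 186] [cite: NeukirchANT1999, II (5.5); Koblitz1984, IV §1]
-/

noncomputable section

open scoped Pointwise

namespace Summit.ABC.IUTFork.Repair.RH.AxisCK3Requirements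

open Literature.IUT.LogVolume Summit.ABC.IUTFork.Repair.RH.DiffPricedHull Summit.ABC.IUTFork.Repair.RH.ReqsideWeightLaws
  Summit.ABC.IUTFork.Repair.RH.AxisCK1Requirements

/-! ## §1. R-K3C-1 / R-K3C-2: the IUT-side objects, typed over `Literature.IUT.LogVolume.TensorPacketRing`, parametric in the radius multiplier `c` -/

section IUTSide

variable (p : ℕ) [Fact p.Prime]
variable {I : Type} [Fintype I] [DecidableEq I]
variable (k : I → Type) [∀ i, NontriviallyNormedField (k i)] [∀ i, NormedAlgebra ℚ_[p] (k i)]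
variable [∀ i, IsUltrametricDist (k i)] [∀ i, ProperSpace (k i)]

/-- **R-K3C-1, radius datum**: a family `h ∈ Π k_i` realising the SCALED outer exponent `−c·b_I`: `‖h_i‖ = p^{c·b_i}` (print, `c = 1`: `RealizesNegB`,
`realizesPowB_one_iff`; the sheets' `c = ½`: `‖h_i‖ = p^{b_i/2}`, `realizesPowB_half_iff`). HYPOTHESIS-side datum in OUR typed currency. [claim: Mochizuki2012, status: disputed] -/
@[claim "Mochizuki2012" "disputed"]
def RealizesPowB (c : ℝ) (h : Π i, k i) : Prop :=
  ∀ i, ‖h i‖ = (p : ℝ) ^ (c * logRadiusB p (absRamificationIdx p (k i)))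

/-- **R-K3C-1 (c-SHELL MULTIRADIAL DISPLAY — replaces `Prop12ii` and `IsLogPacketAut`)** (sheets CFG-13/14/15 item (b) R-K3C-1, verbatim in meaning with `c = ½`):
a unit CONTAINER `C ⊆ R_I ⊗ ℚ_p` and an indeterminacy GROUP `G` (the new theory's (Ind1),(Ind2)) such that every `φ ∈ G` stabilises `C` and, for `ord(g) = λ = m/e_i`,
`φ(p^λ·(R_I)^∼) ⊆ p^{n'}·C ⊆ p^{n' − c·b_I}·(R_I)^∼` with the SCALED inner sacrifice `n' := ⌊λ − d_I − c·a_I⌋` (print: `n = ⌊λ − d_I − a_I⌋`, container `log_p(R_I^×)`,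
reach `b_I`; `|I| ≥ 2` as in Prop 1.1/1.2). At the exact thresholds and `c = ½` this is, in cell currency, the licence `HullCellδ (2e_w) (2m_q) j (2D) R_in R_out` (§2).
HYPOTHESIS in OUR typed currency; nothing asserts such `C`, `G` exist. [claim: Mochizuki2012, status: disputed] -/
@[claim "Mochizuki2012" "disputed"]
def ShellDisplay (c : ℝ) (C : Set (PacketAlgebra p k)) (G : Set (PacketAlgebra p k ≃ₗ[ℚ_[p]] PacketAlgebra p k)) : Prop :=
  2 ≤ Fintype.card I →
  ∀ φ ∈ G, φ '' C = C ∧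
    ∀ (i : I) (m : ℤ) (g : k i), ‖g‖ = (p : ℝ) ^ (-((m : ℝ) / absRamificationIdx p (k i))) →
      ∀ (h : Π i, k i), RealizesPowB p k c h →
        letI n' : ℤ := ⌊(m : ℝ) / absRamificationIdx p (k i) - dSum p k - c * aSum p k⌋
        φ '' (iota p k i g • (normalizedPacket p k : Set (PacketAlgebra p k))) ⊆ ppow p k n' • C ∧
          ppow p k n' • C ⊆ (ppow p k n' * purePacket p k h) • (normalizedPacket p k : Set (PacketAlgebra p k))

/-- **R-K3C-2 (KUMMER-COMPATIBLE UNIT MAP feeding the container — replaces `log_p` on units**; rf-2's (H) first disjunct «a Kummer-compatible replacement of log_p with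
smaller denominators»; sheets item (b) R-K3C-2 verbatim): per factor a map `L_i : k_i → k_i` on `𝒪^×` that is equivariant for the `ℚ_p`-algebra automorphisms of `k_i`
(so definable from the mono-analytic datum `G_v ↷ 𝒪^×μ`), kills exactly the torsion, and whose pure-tensor images lie in `C` (the analogue of [IUTchIII] Prop 3.5 (ii)(a),
Q3-04, for the new container). The tree DECIDES, on the classical side, that `L_i = unitLog` does NOT fit a `c = ½` container: inner radius exact
(`LogEnvelope.innerRadius_closedForm`), outer value attained (`LogEnvelope.exists_mem_logUnits_norm_eq_envelope`) — sheet (c) C1; hence (R-K3C-3) a NEW unit map, not a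
smaller group, is load-bearing. HYPOTHESIS in OUR typed currency. [claim: Mochizuki2012, status: disputed] -/
@[claim "Mochizuki2012" "disputed"]
def ShellKummer (L : Π i, k i → k i) (C : Set (PacketAlgebra p k)) : Prop :=
  (∀ i (σ : k i ≃ₐ[ℚ_[p]] k i) (u : k i), ‖u‖ = 1 → L i (σ u) = σ (L i u)) ∧
  (∀ i (u : k i), ‖u‖ = 1 → (L i u = 0 ↔ ∃ n : ℕ, 0 < n ∧ u ^ n = 1)) ∧
  ∀ z : Π i, k i, (∀ i, ∃ u : k i, ‖u‖ = 1 ∧ L i u = z i) → purePacket p k z ∈ C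

/-- **The assembled IUT-side requirement of a «c-shell theory»** (sheets: `HalfShellTheory := ∃ C G L, HalfShellDisplay C G ∧ HalfShellKummer L C`, here at general `c`;
the family K3-CHALF is `c = ½`; `c = 0` types rf-2's (H) «container with no p-denominators» of the T-points' §C0, left as prose in `AxisCK1Requirements.CFG06_requirement`).
HYPOTHESIS; nothing asserts it holds for any `c < 1`. [claim: Mochizuki2012, status: disputed] -/
@[claim "Mochizuki2012" "disputed"]
def ShellTheory (c : ℝ) : Prop :=
  ∃ (C : Set (PacketAlgebra p k)) (G : Set (PacketAlgebra p k ≃ₗ[ℚ_[p]] PacketAlgebra p k)) (L : Π i, k i → k i),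
    ShellDisplay p k c C G ∧ ShellKummer p k L C

omit [Fintype I] [DecidableEq I] in
/-- At `c = 1` the radius datum IS print's `RealizesNegB`. [folklore] -/
theorem realizesPowB_one_iff (h : Π i, k i) : RealizesPowB p k 1 h ↔ RealizesNegB p k h := by
  simp only [RealizesPowB, RealizesNegB, one_mul]

omit [Fintype I] [DecidableEq I] in
/-- At `c = ½` the radius datum is the sheets' literal `‖h_i‖ = p^{b_i/2}`. [folklore] -/
theorem realizesPowB_half_iff (h : Π i, k i) :
    RealizesPowB p k (1 / 2) h ↔ ∀ i, ‖h i‖ = (p : ℝ) ^ (logRadiusB p (absRamificationIdx p (k i)) / 2) := by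
  simp only [RealizesPowB, one_div_mul_eq_div]

/-- **CALIBRATION (print, `c = 1`)**: with container `log_p(R_I^×)` and group = ALL automorphisms of the log-shell lattice (`IsLogPacketAut`), the display IS
[IUTchIV] Prop 1.2 (ii) as typed (`Prop12ii`; the stabiliser clause is then the membership condition itself). [folklore] -/
theorem shellDisplay_one_logPacket_iff :
    ShellDisplay p k 1 (logPacket p k : Set (PacketAlgebra p k)) {φ | IsLogPacketAut p k φ} ↔ Prop12ii p k := by
  simp only [ShellDisplay, Prop12ii, Set.mem_setOf_eq, realizesPowB_one_iff, one_mul]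
  exact ⟨fun H hI φ hφ => (H hI φ hφ).2, fun H hI φ hφ => ⟨hφ, H hI φ hφ⟩⟩

end IUTSide

/-! ## §2. R-K3C-3 / R-K3C-4: the cell side in the reqside currency (BY NAME over `AxisCK1Requirements`, `ReqsideWeightLaws`, `DiffPricedHull`) -/

section CellSide

variable {ι : Type*}

/-- **R-K3C-3 (the invariant content of `c` is the WIDTH)** — TRANSLATION COVARIANCE of the exact cell (log-volume is translation-covariant): shifting BOTH radii by a
multiple `e·s` of the ramification index leaves `HullCellδ` unchanged, so replacing `log_p` by `p^s·log_p` (which meets R-K3C-2 trivially) changes nothing; what `c = ½`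
asks is a container of WIDTH `(R_in − R_out)/2` still carrying the unit images. At a tame place `R_in = R_out` the multiplier is a half-unit translation visible only
through the floor (`ReqsideWorkedPlace.tame_reversal_p353`, `equalRadii_floorFree_invariant`). [folklore] -/
theorem hullCellδ_translate {e : ℤ} (he : e ≠ 0) (m j δ rin rout s : ℤ) :
    HullCellδ e m j δ (rin + e * s) (rout + e * s) ↔ HullCellδ e m j δ rin rout := by
  unfold HullCellδ
  have h1 : (j ^ 2 * m - j * δ - (j + 1) * (rin + e * s)) / e = (j ^ 2 * m - j * δ - (j + 1) * rin) / e - (j + 1) * s := by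
    have : j ^ 2 * m - j * δ - (j + 1) * (rin + e * s) = (j ^ 2 * m - j * δ - (j + 1) * rin) + e * (-((j + 1) * s)) := by ring
    rw [this, Int.add_mul_ediv_left _ _ he]; ring
  rw [h1]
  constructor <;> intro h <;> nlinarith [h]

/-- **R-K3C-4, LICENCE LAW at `c = ½`** (sheets: «the theory must license, at every bad place `w | p` of the bed data and every label `j ≤ l⋆`,
`HullCellδ (2·e_w) (2·m_q) j (2·D_w) R_in R_out` whenever its display R-K3C-1 holds at `(w, j)`»): the k1 licence law `AxisCK1Requirements.R1_licenceLaw` at the PRINT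
law (`a = 4`, `⌈j²⌉ = j²`) and the DOUBLED place data `(2e, 2m, 2δ; r_in, r_out)` — the radius multiplier `c = ½` in «floor AFTER multiplication» form (REQB-SPEC §6(b);
`ReqsideShellProfile` §1 `N = 2, a = 1, a_D = 2`). HYPOTHESIS in OUR typed cell currency. [claim: Mochizuki2012, status: disputed] -/
@[claim "Mochizuki2012" "disputed"]
def K3CHalf_licenceLaw (s : Finset ι) (e m δ rin rout : ι → ℤ) (L : ℕ) (licensed : ι → ℕ → Prop) : Prop :=
  R1_licenceLaw 4 s (fun w => 2 * e w) (fun w => 2 * m w) (fun w => 2 * δ w) rin rout L licensed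

/-- **R-K3C-4, MEETS WORD per datum at threshold `μ₀`** (the table's deciding comparison `K_L1 ≥ μ₀·M`, tier L1): `AxisCK1Requirements.R1_meets 4 μ₀` at the doubled
place. In the rows' kernel ledgers (`ReqsidePairPK3CM2764.targets_le_kept_of_cert` / `meets_of_certs`, p516979; `ReqsidePairPK3CM12.half_of_targets`, p521062) the
doubled place carries mass `2M` and deficit `2·DD(½)` (the doubled margins, `cell_four_doubled_iff_twiceMargin`), so the factor 2 cancels: the SAME word
`DD(½) ≤ (1 − μ₀)·M`. HYPOTHESIS in OUR typed cell currency. [claim: Mochizuki2012, status: disputed] -/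
@[claim "Mochizuki2012" "disputed"]
def K3CHalf_meets (μ₀ : ℝ) (s : Finset ι) (e m δ rin rout : ι → ℤ) (u : ι → ℝ) (L : ℕ) : Prop :=
  R1_meets 4 μ₀ s (fun w => 2 * e w) (fun w => 2 * m w) (fun w => 2 * δ w) rin rout u L

/-- CALIBRATION: label by label the `c = ½` licence IS the exact cell `HullCellδ (2e_w) (2m_w) j (2δ_w) r_in r_out` of record (`R1_licenceLaw_four_iff` at the doubled
place; the currency of `ReqsideWorkedPlace.cHalf_boundary`: at FREY `p = 7`, `l = 107` it keeps 19 of print's 31 labels). [folklore] -/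
theorem K3CHalf_licenceLaw_iff (s : Finset ι) (e m δ rin rout : ι → ℤ) (L : ℕ) (licensed : ι → ℕ → Prop) :
    K3CHalf_licenceLaw s e m δ rin rout L licensed ↔
      ∀ w ∈ s, ∀ j, 1 ≤ j → j ≤ L → (licensed w j ↔ HullCellδ (2 * e w) (2 * m w) j (2 * δ w) (rin w) (rout w)) := by
  unfold K3CHalf_licenceLaw
  exact R1_licenceLaw_four_iff s _ _ _ rin rout L licensed

/-- CALIBRATION against the row ledgers: the print-law cell at the doubled place IS «twice-margin `≥ 0`», `2·margin_j(½) = (2m − (j+1)·r_out) − 2e·⌊(j²·2m − j·2D −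
(j+1)·r_in)/(2e)⌋` (`ReqsidePairPK3CM2764.twiceMargin_nonneg_iff`, by name). [folklore] -/
theorem cell_four_doubled_iff_twiceMargin (e m δ rin rout : ℤ) (j : ℕ) :
    Cell (lawPow 4) 1 (2 * e) (2 * m) (2 * δ) rin rout j ↔
      0 ≤ (2 * m - ((j : ℤ) + 1) * rout) - 2 * e * (((j : ℤ) ^ 2 * (2 * m) - (j : ℤ) * (2 * δ) - ((j : ℤ) + 1) * rin) / (2 * e)) :=
  (cell_lawPow_four_iff_hullCellδ (2 * e) (2 * m) (2 * δ) rin rout j).trans (ReqsidePairPK3CM2764.twiceMargin_nonneg_iff e m δ rin rout j).symm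

/-- CONE-SAFETY BY NAME (sheets (c) C3): under the structural signs `0 < e`, `0 ≤ j`, `0 ≤ D`, `0 ≤ R_in`, `R_out ≤ 0` the `c = ½` cell IMPLIES print's cell — fewer
labels, never more (`ReqsideShellProfile.multiplierCell_le_print` at `N = 2, a = 1, a_D = 2`, p507493). [folklore] -/
theorem hullCellδ_cHalf_le_print {e m j δ rin rout : ℤ} (he : 0 < e) (hj : 0 ≤ j) (hδ : 0 ≤ δ) (hrin : 0 ≤ rin) (hrout : rout ≤ 0)
    (h : HullCellδ (2 * e) (2 * m) j (2 * δ) rin rout) : HullCellδ e m j δ rin rout :=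
  ReqsideShellProfile.multiplierCell_le_print (N := 2) (a := 1) (aD := 2) he (by norm_num) hj (by norm_num) le_rfl hδ hrin hrout
    (by simpa only [one_mul] using h)

/-- The MEETS word IS the vanishing of the tier-L1 threshold of record for the doubled-place mass and deficit (`R1_meets_iff_reqThreshold_eq_zero` at law `4`;
`datum_meets_iff` p522952, `reqThreshold` p508156). [folklore] -/
theorem K3CHalf_meets_iff_reqThreshold_eq_zero (μ₀ : ℝ) (s : Finset ι) (e m δ rin rout : ι → ℤ) (u : ι → ℝ) (L : ℕ) :
    K3CHalf_meets μ₀ s e m δ rin rout u L ↔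
      reqThreshold μ₀ (reqMass (lawPow 4) 1 L (∑ w ∈ s, ((2 * m w : ℤ) : ℝ) * u w))
        (reqMass (lawPow 4) 1 L (∑ w ∈ s, ((2 * m w : ℤ) : ℝ) * u w)
          - datumDeficit (lawPow 4) 1 s (fun w => 2 * e w) (fun w => 2 * m w) (fun w => 2 * δ w) rin rout u L) = 0 := by
  unfold K3CHalf_meets
  exact R1_meets_iff_reqThreshold_eq_zero 4 μ₀ s _ _ _ rin rout u L

/-- R8 direction BY NAME: the `μ₀ = ½` word implies the `μ₀ = 27/64` word whenever the (doubled) mass is `≥ 0` (`R1_meets_anti`; the rows' certificate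
`ReqsidePairPK3CM2764.targets_le_kept_of_cert` gives both targets at once). [folklore] -/
theorem K3CHalf_meets_2764_of_half {s : Finset ι} {e m δ rin rout : ι → ℤ} {u : ι → ℝ} {L : ℕ}
    (hM : 0 ≤ reqMass (lawPow 4) 1 L (∑ w ∈ s, ((2 * m w : ℤ) : ℝ) * u w))
    (h : K3CHalf_meets (1 / 2) s e m δ rin rout u L) : K3CHalf_meets (27 / 64) s e m δ rin rout u L := by
  unfold K3CHalf_meets at h ⊢
  exact R1_meets_anti (by norm_num) hM h

end CellSide

/-! ## §3. CFG-13 (`μ₀ = 27/64`) and CFG-14 (`μ₀ = ½`): family K3-CHALF, pair points `P-k3c1/2-k5mu…` -/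

section Packaging

variable (p : ℕ) [Fact p.Prime]
variable {I : Type} [Fintype I] [DecidableEq I]
variable (k : I → Type) [∀ i, NontriviallyNormedField (k i)] [∀ i, NormedAlgebra ℚ_[p] (k i)]
variable [∀ i, IsUltrametricDist (k i)] [∀ i, ProperSpace (k i)]
variable {ι : Type*}

/-- **CFG-13** (point_id `P-k3c1/2-k5mu27/64`; knobs «k1=print k2=print c=1/2 cD=1 pk=j+1 rnd=floor mu0=27/64»; sheet `AXIS-C/CFG-13-P-k3c1_2-k5mu27_64.md` v3
d0138c547453c812 (rh3-gen-5) items R-K3C-1…4, R-K5-1; loci of (a): [IUTchIV] Prop 1.2 (i) p.10 l.65 + proof p.11 l.18–19 (Q3-05/06: the radii are equalities),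
[IUTchIII] Thm 3.11 (i) p.154 l.52/61–62 (Q3-01/02: (Ind1),(Ind2)), Prop 3.5 (ii)(a) p.104 l.42–43 (Q3-04), [IUTchIV] Thm 1.10 Step (v)–(vi) p.27–29 (Q3-07/08), Rmk
3.12.1 (ii) p.186 ([L4] λ-link); label INCONSISTENT, located not adjudicated) — «what a c = ½ log-shell theory with threshold μ₀ = 27/64 must SUPPLY», per packet
`(p, I, k)` and PER DATUM (places `s`, integer place data `(e, m, δ, r_in, r_out)`, weights `u`, `L = l⋆` labels, licence assignment `licensed`): the IUT-side half-shell
theory `ShellTheory p k (1/2)` (R-K3C-1/2) AND the cell block — the `c = ½` licence law with the MEETS word at `μ₀ = 27/64` (R-K3C-4; faces of record DECIDING the word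
on the genuine bed, 133/133 ∧ 79/79: `ReqsidePairPK3CM2764.targets_le_kept_of_cert` / `meets_of_certs` / `workedDatum_meets` / `hex_meets_1…6` (p516979) and the FREY133
part `ReqsidePairPK3CM2764Frey` (p517950), by name). R-K5-1 (`μ₀ = 27/64`) is PRINT-DEFINABLE ([L4] λ-link, `λ = 557 + 5/32` at `l = 107`, rider (c3) `⌈λ⌉ = 558`) and
enters only through `μ₀`. R-K3C-4's DOWNSTREAM clause («carry the Step (x)/Prop 3.9 log-volume bookkeeping with `(a_I, b_I) ↦` halves so that
`ReqsideShellProfile.thm110LegendreWith_of_pointwise` / `abcExp_of_pointwise` (p507493) apply unchanged») is PROSE in the sheet (no signature) and stays prose here.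
HYPOTHESIS in OUR typed cell currency; nothing asserts such a theory exists. [claim: Mochizuki2012, status: disputed] -/
@[claim "Mochizuki2012" "disputed"]
def CFG13_requirement (s : Finset ι) (e m δ rin rout : ι → ℤ) (u : ι → ℝ) (L : ℕ) (licensed : ι → ℕ → Prop) : Prop :=
  ShellTheory p k (1 / 2) ∧ (K3CHalf_licenceLaw s e m δ rin rout L licensed ∧ K3CHalf_meets (27 / 64) s e m δ rin rout u L)

/-- **CFG-14** (point_id `P-k3c1/2-k5mu1/2`; knobs «k1=print k2=print c=1/2 cD=1 pk=j+1 rnd=floor mu0=1/2»; sheet `AXIS-C/CFG-14-P-k3c1_2-k5mu1_2.md` v3 cce89367b8151f51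
(rh3-gen-5), items and loci as CFG-13 with R-K5-1 at `μ₀ = ½` (INTEGER λ-link [L14], `λ = 482` at `l = 107`); label INCONSISTENT, located not adjudicated) — CFG-13's
list with `μ₀ := ½` in the MEETS word (faces of record: `ReqsidePairPK3CM12.half_of_targets` / `workedDatum_meets_half` / `hex_half_1…6` / `frey_half_1…12` (p521062),
by name; the table's min kept-ratio words are the sheets', no kernel numeral here). HYPOTHESIS in OUR typed cell currency. [claim: Mochizuki2012, status: disputed] -/
@[claim "Mochizuki2012" "disputed"]
def CFG14_requirement (s : Finset ι) (e m δ rin rout : ι → ℤ) (u : ι → ℝ) (L : ℕ) (licensed : ι → ℕ → Prop) : Prop :=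
  ShellTheory p k (1 / 2) ∧ (K3CHalf_licenceLaw s e m δ rin rout L licensed ∧ K3CHalf_meets (1 / 2) s e m δ rin rout u L)

/-- R8 direction at the packaging level: a packet/datum meeting CFG-14's requirement meets CFG-13's whenever the doubled mass is `≥ 0` (`K3CHalf_meets_2764_of_half`;
cf. the table word «½ ⟹ 27/64», `pairPK32M2764_of_pairPK32M12`-shape). [folklore] -/
theorem CFG13_of_CFG14 {s : Finset ι} {e m δ rin rout : ι → ℤ} {u : ι → ℝ} {L : ℕ} {licensed : ι → ℕ → Prop}
    (hM : 0 ≤ reqMass (lawPow 4) 1 L (∑ w ∈ s, ((2 * m w : ℤ) : ℝ) * u w))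
    (h : CFG14_requirement p k s e m δ rin rout u L licensed) : CFG13_requirement p k s e m δ rin rout u L licensed :=
  ⟨h.1, h.2.1, K3CHalf_meets_2764_of_half hM h.2.2⟩

/-! ## §4. CFG-15 (`T-k1kappa3/2-k3c1/2-k5mu1/2`): the k1 block of `RHAxisCK1Requirements` AND the k3 half, assembled -/

/-- **CFG-15** (point_id `T-k1kappa3/2-k3c1/2-k5mu1/2`; knobs «k1=kappa:3/2 k2=print c=1/2 cD=1 pk=j+1 rnd=floor mu0=1/2»; sheet
`AXIS-C/CFG-15-T-k1kappa3_2-k3c1_2-k5mu1_2.md` v3 b45c88f34256b594 (rh3-gen-5) items R-K3C-1…4, R-K1, R-T, R-K5-1; loci of (a) as CFG-13 + CFG-05's ([EtTh] Prop 1.4/1.5,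
[IUTchIII] Cor 3.12); label INCONSISTENT with k1 NEW-THEORY tag, located not adjudicated) — TWO INDEPENDENT NEW THEORIES plus their CONJUNCTION at the doubled cell
(rf-2 §2): `AxisCK1Requirements.CFG15_k1block` (R-K1 = CFG-05 §K32-CORE R1–R6 with R1 = licence law `Cell (lawPow 3) 1 (2e_w) (2m_q) (2D_w) R_in R_out` + MEETS word at
`μ₀ = ½` at the DOUBLED place — R-T «R-K1's R1 evaluated INSIDE R-K3C-1's half-shell container»; faces `ReqsidePairTK32CHM12.cell_cHalf_iff_margin` /
`half_le_kept_of_placewise` / `reqThreshold_half_eq_zero_of_placewise` / `datumA_word_L1` / `datumB_word_L1`, p516681 — the sheet's third conjunct «∀ datum ∈ FREY133 ∪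
HEX79, reqThreshold ½ M_{3/2} K_L1 = 0» is that THEOREM, by name, not part of the hypothesis) AND the k3 half `ShellTheory p k (1/2)` (R-K3C-1/2). NEITHER implies the
other (κ acts on the demand `⌈j^{3/2}⌉·m_q`, `c` on the price `(j+1)(R_in, R_out)/2`; kernel bracket `ReqsideWeightLaws.pair_bracket_lawPow`, p520993: the pair's off-demand
lies BETWEEN the singles'). HYPOTHESIS in OUR typed cell currency; nothing asserts either theory exists. [claim: Mochizuki2012, status: disputed] -/
@[claim "Mochizuki2012" "disputed"]
def CFG15_requirement (s : Finset ι) (e m δ rin rout : ι → ℤ) (u : ι → ℝ) (L : ℕ) (licensed : ι → ℕ → Prop) : Prop :=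
  CFG15_k1block s e m δ rin rout u L licensed ∧ ShellTheory p k (1 / 2)

end Packaging

end Summit.ABC.IUTFork.Repair.RH.AxisCK3Requirements

end
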